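import Summits.QuantumAdvantage.QuantumAdvantage.Theses.ExactnessDial
import Summits.QuantumAdvantage.QuantumAdvantage.Theorems.RingPeriodFoldStrategies
import Summits.QuantumAdvantage.QuantumAdvantage.Theorems.WildDialDollA
import HarnessLib

/-! # LightDialA — part 1/2 of the landing twins of NODE «LightDial» (decomp-qadv lens-2 g26; node file
`g26/LightDial.lean`, sha256 b37b6f5b9e1969d4…; generator `g26/tree/gen_twins.py`: namespace `Theses.LightDial` →
`Theorems.LightDial`, cut at the §2/§3 section boundary (node lines 106–311; REV 1), nothing else).
Content: §1 light inputs (`wt`, `ind`, `onesOf`, `oddZeros_ind_iff`), the dial statements `lightLosing` / `LightFail` (special = LIGHT, the law-bet), `heavyLosing` / `HeavyFail` (generic = HEAVY, the WLOG layer), `lightCovLosing` (covariant census cell); the NODE `closes : LightFail 2 w → ExactnessDial.NoPerfectTwo3` BY NAME and `closes_const` (→ `NoPerfectConst3`); the EQUIV layer `losing_iff_heavy` / `noPerfectTwo3_iff_heavy`; monotonicity `lightFail_mono` / `lightFail_anti` / `lightLosing_top`; the cell junctions `covLosing_of_lightCov`, `covLosing_mul_of_lightCov`; §2 solvability of the ring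 relation on the odd class (`exists_rel_of_oddZeros`, using tree `WildDialDoll.dot2_indicator`). -/

/-!
# LightDial — decomp-qadv lens-2 (structural dichotomy: special vs generic), generation 26

TARGET (by name): `T := Summit.QuantumAdvantage.QuantumAdvantage.Theses.ExactnessDial.NoPerfectTwo3` (stmt-QuantumAdvantage-27432,
OPEN: «eventually in `n`, every `𝔽₃`-degree-`≤ 2` strategy of the cyclic ring game `RingHLF.Rel` loses on some odd-class input»),
with the constant-degree rung `NoPerfectConst3` (27380) as schema (`closes_const`) and the one-length slices `losing D`,
`covLosing D` of the lineage's g7 file (tree `Theorems.RingPeriodFold[Strategies]`).  WHY THIS TARGET (residual mode, blocker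
first): every `p = 3` residual of this cell — the lineage's own G = `Theorems.AbelianDial.NonAbelianLoss3` → g24 `TernaryLoss3` →
g25 `NonPhaseLoss3` (IDEA-NEEDED), lens-1/4/5's XOR-law residuals, DWalkThree's 22907 — bottoms out at the EXACT QUADRATIC CELL:
perfect covariant quadratics EXIST at `n = 10, 11` (census DATA `q_10_2`, `q_11_2`), `n = 12` is undecided (margin −46.8 bits),
g25's first open phase cell is `(2,1,2) ⟸ RingDegLoss 3 6`, lens-5's tower waits for the cell `(2,16)` (`IndexDial.cell16_tower`).
Gens 17–25 of this lineage dialled the STRATEGY (gauge classes: table / counter / abelian / 𝔽₂-shadow / polynomial phase); g6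
dialled its RANK; on that axis the syntactic special classes are exhausted and the generic side is the analytic XOR law nobody can
touch (census verdict IDEA-NEEDED ×3).  This generation dials the OTHER argument of the game: the INPUT.

THE DIAL (special vs generic INPUTS).  SPECIAL := LIGHT odd-class inputs, Hamming weight `wt x ≤ w` (dihedral walks with at
most `w` rotation letters; `w` is the dial).  GENERIC := heavy inputs.  Two facts make the light side a different game:
(1) LINEARIZATION LAW (§3, PROVED `linearization`): on the inputs `ind A` a degree-`≤ D` polynomial IS the degree-`≤ D` SET
    FUNCTION `A ↦ Σ_{S ⊆ A, |S| ≤ D} c_S` of its monomial table — restricted to the light family a strategy is a point of the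
    JOHNSON-SCHEME module spanned by the `≤ D`-subset inclusion vectors (Wilson / Frankl–Wilson inclusion-matrix territory,
    a cross-characteristic toolbox not yet in this cell's cone), and each output bit on a weight-`w` input reads only
    `1 + w + C(w,2)` (quadratic case) of the coefficients;
(2) COUNTING: a covariant quadratic has `1 + n + C(n,2) ≈ 0.79·n²` bits of freedom, the light orbits of weight `≤ 5` impose
    `≈ n⁴/120` XOR constraints — overdetermined from `n ≈ 14–16` on, while the instance stays TINY (`n = 16`: `137` trits,
    `309` orbit constraints, `≤ 16` trits per output bit, §7) against the full odd class (`2048` orbits) the census cannot close.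
    Non-covariant: `≈ 0.79·n³` bits vs `C(n,5)`: overdetermined from `n ≈ 18–20`.

NODE (kernel-checked here, `lean check` rc 0 · 0 sorry · 0 warning):
  `T ⟺ HeavyFail 2 w`  (EQUIV layer, every `w`: `noPerfectTwo3_iff_heavy`; one length: `losing_iff_heavy`)   [COSTUME by construction —
       its content is the NORMAL FORM «a would-be perfect quadratic strategy may be assumed to solve the light design equations»]
  `T ⟸ LightFail 2 w`  (`closes`, any `w`; `closes_const` for 27380; one length `mem_losing_of_light`)            [STRENGTHENING, law-bet:
       UNDECIDED (test = census K-LD1 below); NOT T-implied — bc F4]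
  pieces of record:  `LightFail D w := ∃ n₀, ∀ n ≥ n₀, n ∈ lightLosing D w`,  `lightLosing D w := {n | every degree-≤D strategy is
  defeated by an odd input of weight ≤ w}`,  `heavyLosing`, `lightCovLosing` (covariant slice = the census cell).
LAWS (all PROVED): dial MONOTONE in `w` (`lightFail_mono`), ANTITONE in `D` (`lightFail_anti`), TOP = the slice (`lightLosing_top`:
  `w ≥ n`); ★ FLOOR `¬ LightFail D w` for every `w ≤ D` (`not_lightFail_of_le`, in particular `¬ LightFail 2 2`): degree-`D`
  polynomials INTERPOLATE arbitrary valid answers on the inputs of weight `≤ D` (truncated MÖBIUS inversion `setFn_mobius` +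
  solvability of the ring relation on the odd class `exists_rel_of_oddZeros`, kernel `{0, kvec x}`) — so the quadratic dial starts
  at `w = 3` and the census need not test below; ★ TENSION LAW (`parity_not_lowDeg`, every `D`; `parity_not_quadratic`): NO
  `𝔽₃`-polynomial of degree `≤ D` computes the weight PARITY on the light inputs of weight `≤ D + 1` (the `(D+1)`-st discrete
  derivative `altSum` kills degree `≤ D` set functions, `altSum_setFn`, but equals `(-1)^{D+1} ≠ 0` on parity, `altSum_parity3`) — the
  referee's prefix reflection-parities `u_i` are prefix-weight parities, so already at weight `3` a quadratic output cannot track the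
  walk: the mod-2/mod-3 mismatch of the ring game in its minimal, input-structured form (why the law-bet is not absurd);
  ★ LIGHT UNIVERSAL HARDNESS FOR LOCAL RULES (`light_universalHard_window`, from lens-1's tree theorems `xU_universalHard` /
  `xUO_universalHard` with the weight made explicit `wt_xU ≤ 3`, `wt_xUO ≤ 6`): for every radius `r`, `n ≥ 6r+9`, ONE light input of
  weight `≤ 6` defeats EVERY window-`r` strategy — the light family is exactly where locality already loses (BC5-type witness that
  the special side carries hardness); CELLS: `lightCovLosing D w ∋ n → covLosing D ∋ n` (`covLosing_of_lightCov`), fold amplifier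
  `covLosing_mul_of_lightCov` (g7 `covNotPerfectAt_mul`), ★ `tower16_of_lightCov : 16 ∈ lightCovLosing 2 w → ∀ j, 16·3^j ∈ covLosing 2`
  (lens-5 `IndexDial.cell16_tower`): ONE light covariant UNSAT certificate at `n = 16` settles the whole tower.
LEAVES: `LightFail 2 w` (w = 5 or 7) — INSTRUMENTABLE now (K-LD1) and ATTACKABLE asymptotically (inclusion-matrix rank / design
  theory mod 3 against the explicit light kernel vectors); `HeavyFail` — the old generic side (IDEA-NEEDED) but now with a NORMAL FORM.
CENSUS ASK K-LD1 (to decomp-qadv-census-1, kit tag qa): E^{cov}(n, w) := «∃ covariant quadratic Q perfect on all odd-class inputs of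
  weight ≤ w of C_n» for n = 12..32, w ∈ {3,5,7} (n even) / {2,4,6} (n odd): unknowns c_S (|S| ≤ 2), one XOR constraint per light
  orbit `⊕_{b ∈ supp kvec(ind A)} [Σ_{S ⊆ (A − b)} c_S = 1] = signBit`; UNSAT at (n, w) ⟹ `n ∈ covLosing 2` (new exact cells, all
  beyond the census's n = 12 wall; n = 16 feeds the tower); SAT everywhere up to 32 ⟹ the law-bet at that w is numerically dead (raise w
  or retire the dial: either outcome informative).  K-LD2: non-covariant E(n, 5), n = 12..18.  K-LD3: affine D = 1, locate the exact
  light threshold w*(1, n) (affine is impossible on the full class for 7 ≤ n ≤ 14; on which light family does it already die?).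
  ★ K-LD3 PILOT DONE HERE (covariant affine, local brute force < 20 CPU-s, `num/light_affine_cov.py`, `num/TABLE.md`): w*(1, n) =
  6, 5, 4, 5, 4, 5, 4 for n = 7..13 — from n = 8 on a FIXED light layer (weight ≤ 5 for even n, ≤ 4 for odd n) already defeats every
  covariant affine rule (`n ∈ lightCovLosing 1 5`, 8 ≤ n ≤ 13), and the weight-≤3 survivors at even n shrink 180 → 144 → 24 (n = 8, 10, 12):
  the empirical shape of `LightFail 1 5`, i.e. the dial is NOT dead one degree down.
WHY THIS IS NOVEL (one sentence): no node of this cell restricts the INPUTS — all 25 lens-2 generations, g6's rank dial and the other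
  lenses' residual chains dial the strategy — and the light restriction is the one move that simultaneously linearizes the strategy
  (Johnson-scheme set functions), makes the hidden walk explicit (≤ w rotation letters) and shrinks the deciding SAT instances by
  two orders of magnitude while its UNSAT certificates remain certificates for T's cells (`mem_losing_of_light`).
BARRIERS: TwoModuliDepthTwo (MOD₂∘MOD₃∘AND₂) is not evaded by the statement — the bet is that on the light family the depth-two
  object degenerates to a bounded-width design problem (each output reads ≤ 16 coefficients) where inclusion-matrix rank arguments,
  not correlation bounds, apply; the equidistribution/correlation toolbox is recorded as INSUFFICIENT for the heavy side (parity is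
  not fooled by k-wise phase equidistribution: ℓ¹ Fourier mass (5/3)^{#charged}, ℓ² mass 3^n·CP ≥ (3/2)^n — lineage note g26).
HONEST LIMITS: (i) `LightFail` is a STRENGTHENING of T, not a T-implied piece — if for every fixed w perfect-on-light quadratics
  persist for all n, the dial is dead and says so (K-LD1 decides it cheaply); (ii) light families have density `n^w·2^{-n}`, so NOTHING
  here bears on the 1/poly-density residuals (27009-chain) — the node lives at the EXACT grade only; (iii) nothing here proves 27432,
  27380 or the summit: rung 0, cell currency.
REV 1 (writer PREFLIGHT 15:09:03Z + critic 69v62 caveat): the two restatements of landed bookkeeping lemmas are gone (`dot2_zero_left` =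
  tree `Fib19.dot2_zero_left`, unused here; `dot2_single` = tree `WildDialDoll.dot2_indicator`, now imported and used by name); the one-liner
  `NoPerfectConst3 → NoPerfectTwo3` is dropped (audit classified it proof-of-item modulo 27380; nothing used it); the lens-5 tower junction
  `tower16_of_lightCov` moved to §6b so that landing twin A imports no WildDial/IndexDial route module (theses-cone warning); statements unchanged.
-/

set_option linter.dupNamespace false
noncomputable section
open scoped Classical

namespace Summit.QuantumAdvantage.QuantumAdvantage.Theorems.LightDial
open Finset
open Literature.Computability.QuantumComplexity Literature.Computability.QuantumComplexity.RingHLF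
open Literature.Computability.MetaComplexity Literature.Computability.MetaComplexity.Smolensky
open Summit.QuantumAdvantage.AdviceFreeQNC0
open Summit.QuantumAdvantage.QuantumAdvantage.Theorems.RingPeriodFold
  (kvec kernel_pair_of_oddZeros kvec_ne_zero rel_iff_of_kernel_pair cov covStrat cov_eq_covStrat covStrat_mem_lowDeg
   covLosing mem_covLosing losing mem_losing covNotPerfectAt_mul notPerfect_iff_aperiodic usablePeriods equivariant)
open Summit.QuantumAdvantage.QuantumAdvantage.Theorems.WildDialDoll (dot2_indicator)
open Summit.QuantumAdvantage.QuantumAdvantage.Theses.ExactnessDial (NoPerfectTwo3 NoPerfectConst3)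

variable {n : ℕ}

/-! ## §1 Light inputs, the dial statements, the WLOG layer -/

/-- Hamming WEIGHT (number of ones = rotation letters of the dihedral walk) of a ring input. -/
def wt (x : Fin n → Bool) : ℕ := (univ.filter fun i : Fin n => x i = true).card

/-- the input whose ones are exactly the positions of `A`. -/
def ind (A : Finset (Fin n)) : Fin n → Bool := fun i => decide (i ∈ A)

/-- the set of ones of an input. -/
def onesOf (x : Fin n → Bool) : Finset (Fin n) := univ.filter fun i : Fin n => x i = true

/-- the indicator input, pointwise (definitional). -/
theorem ind_apply (A : Finset (Fin n)) (i : Fin n) : ind A i = decide (i ∈ A) := rfl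

/-- a coordinate of `ind A` is `true` iff the position lies in `A`. -/
theorem ind_eq_true_iff (A : Finset (Fin n)) (i : Fin n) : ind A i = true ↔ i ∈ A := by
  simp [ind]

/-- the ones of an indicator input are the indexed set. -/
@[simp] theorem onesOf_ind (A : Finset (Fin n)) : onesOf (ind A) = A := by
  ext i; simp [onesOf, ind]

/-- every input is the indicator of its set of ones. -/
@[simp] theorem ind_onesOf (x : Fin n → Bool) : ind (onesOf x) = x := by
  funext i; cases h : x i <;> simp [ind, onesOf, h]

/-- the weight is the number of ones (definitional). -/
theorem wt_eq_card_onesOf (x : Fin n → Bool) : wt x = (onesOf x).card := rfl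

/-- the weight of an indicator input is the size of the set. -/
@[simp] theorem wt_ind (A : Finset (Fin n)) : wt (ind A) = A.card := by
  rw [wt_eq_card_onesOf, onesOf_ind]

/-- zeros of `ind A` are the complement of `A`. -/
theorem card_zeros_ind (A : Finset (Fin n)) : (univ.filter fun i : Fin n => ind A i = false).card = n - A.card := by
  have : (univ.filter fun i : Fin n => ind A i = false) = Aᶜ := by
    ext i; simp [ind]
  rw [this, card_compl, Fintype.card_fin]

/-- the odd class among light inputs: `ind A` has an odd number of zeros iff `n - |A|` is odd. -/
theorem oddZeros_ind_iff (A : Finset (Fin n)) : OddZeros (ind A) ↔ (n - A.card) % 2 = 1 := by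
  unfold OddZeros; rw [card_zeros_ind]

/-- LIGHT FAILURE at one length: every strategy of `𝔽₃`-degree `≤ D` is defeated by an odd-class input of weight `≤ w`
(the SPECIAL = structured inputs: dihedral walks with at most `w` rotation letters). -/
def lightLosing (D w : ℕ) : Set ℕ :=
  {n | ∀ P : Fin n → CubeFn (ZMod 3) n, (∀ i, P i ∈ lowDeg (ZMod 3) n D) →
    ∃ x : Fin n → Bool, OddZeros x ∧ wt x ≤ w ∧ ¬ Rel x (fun i => decide (P i x = 1))}

/-- membership in `lightLosing` (definitional). -/
theorem mem_lightLosing (D w n : ℕ) :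
    n ∈ lightLosing D w ↔ ∀ P : Fin n → CubeFn (ZMod 3) n, (∀ i, P i ∈ lowDeg (ZMod 3) n D) →
      ∃ x : Fin n → Bool, OddZeros x ∧ wt x ≤ w ∧ ¬ Rel x (fun i => decide (P i x = 1)) := Iff.rfl

/-- ★ THE DIAL STATEMENT `LightFail D w` (law-bet, UNDECIDED): eventually in `n`, every degree-`≤ D` strategy already fails on a
LIGHT odd-class input (weight `≤ w`).  `w ↦ LightFail D w` is monotone (`lightFail_mono`), FALSE for `w ≤ D` (`not_lightFail_of_le`,
interpolation) and implies the exact degree rung (`closes`). -/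
def LightFail (D w : ℕ) : Prop := ∃ n₀ : ℕ, ∀ n ≥ n₀, n ∈ lightLosing D w

/-- HEAVY FAILURE at one length (the WLOG layer): every degree-`≤ D` strategy that is PERFECT ON THE LIGHT odd inputs of weight
`≤ w` is defeated by some odd-class input (necessarily of weight `> w`). -/
def heavyLosing (D w : ℕ) : Set ℕ :=
  {n | ∀ P : Fin n → CubeFn (ZMod 3) n, (∀ i, P i ∈ lowDeg (ZMod 3) n D) →
    (∀ x : Fin n → Bool, OddZeros x → wt x ≤ w → Rel x (fun i => decide (P i x = 1))) →
    ∃ x : Fin n → Bool, OddZeros x ∧ ¬ Rel x (fun i => decide (P i x = 1))}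

/-- `HeavyFail D w`: eventually every degree-`≤ D` strategy perfect on the light inputs fails (on a heavy one). -/
def HeavyFail (D w : ℕ) : Prop := ∃ n₀ : ℕ, ∀ n ≥ n₀, n ∈ heavyLosing D w

/-- COVARIANT LIGHT FAILURE at one length (the census cell): every rotation-covariant rule `cov Q` of degree `≤ D` is defeated by
a light odd-class input. -/
def lightCovLosing (D w : ℕ) : Set ℕ :=
  {n | ∀ Q : CubeFn (ZMod 3) n, Q ∈ lowDeg (ZMod 3) n D → ∃ x : Fin n → Bool, OddZeros x ∧ wt x ≤ w ∧ ¬ Rel x (cov Q x)}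

/-- membership in `lightCovLosing` (definitional). -/
theorem mem_lightCovLosing (D w n : ℕ) :
    n ∈ lightCovLosing D w ↔ ∀ Q : CubeFn (ZMod 3) n, Q ∈ lowDeg (ZMod 3) n D →
      ∃ x : Fin n → Bool, OddZeros x ∧ wt x ≤ w ∧ ¬ Rel x (cov Q x) := Iff.rfl

/-! ### the target by name and its slices -/

/-- ExactnessDial's `NoPerfectTwo3` (stmt-QuantumAdvantage-27432) IS «eventually every length is in `losing 2`» (bodies agree). -/
theorem noPerfectTwo3_iff_losing : NoPerfectTwo3 ↔ ∃ n₀ : ℕ, ∀ n ≥ n₀, n ∈ losing 2 := Iff.rfl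

/-- ExactnessDial's `NoPerfectConst3` (stmt-QuantumAdvantage-27380) IS «for every degree, eventually every length is in `losing D`». -/
theorem noPerfectConst3_iff_losing : NoPerfectConst3 ↔ ∀ D : ℕ, ∃ n₀ : ℕ, ∀ n ≥ n₀, n ∈ losing D := Iff.rfl

/-- record (lineage g7, tree `notPerfect_iff_aperiodic`): WLOG the quadratic strategy has no usable period. -/
theorem noPerfectTwo3_iff_aperiodic :
    NoPerfectTwo3 ↔ ∃ n₀ : ℕ, ∀ n ≥ n₀, ∀ P : Fin n → CubeFn (ZMod 3) n, (∀ b, P b ∈ lowDeg (ZMod 3) n 2) →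
      (∀ d ∈ usablePeriods n₀ n, P ∉ equivariant d n) →
      ∃ x : Fin n → Bool, OddZeros x ∧ ¬ Rel x (fun b => decide (P b x = 1)) :=
  noPerfectTwo3_iff_losing.trans (notPerfect_iff_aperiodic 2)

/-! ### junctions: light ⊆ losing ⊆(=) heavy; covariant slice; monotonicity -/

/-- a light defeat is a defeat. -/
theorem lightLosing_subset_losing (D w : ℕ) : lightLosing D w ⊆ losing D := by
  intro n hn P hP
  obtain ⟨x, hx, -, hR⟩ := hn P hP
  exact ⟨x, hx, hR⟩

/-- ★ `closes`: the dial statement at degree `2` (any weight bound `w`) gives ExactnessDial's `NoPerfectTwo3` BY NAME. -/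
theorem closes (w : ℕ) (h : LightFail 2 w) : NoPerfectTwo3 := by
  obtain ⟨n₀, hn₀⟩ := h
  exact ⟨n₀, fun n hn => lightLosing_subset_losing 2 w (hn₀ n hn)⟩

/-- `closes` for the whole constant-degree rung: a weight bound `w(D)` per degree gives `NoPerfectConst3` BY NAME. -/
theorem closes_const (h : ∀ D : ℕ, ∃ w : ℕ, LightFail D w) : NoPerfectConst3 := by
  intro D
  obtain ⟨w, n₀, hn₀⟩ := h D
  exact ⟨n₀, fun n hn => lightLosing_subset_losing D w (hn₀ n hn)⟩

/-- one-length version: a light certificate at length `n` puts `n` in `losing D` (a cell of the exact degree rung, ALL strategies). -/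
theorem mem_losing_of_light {D w : ℕ} (h : n ∈ lightLosing D w) : n ∈ losing D := lightLosing_subset_losing D w h

/-- ★ EQUIV LAYER (one length): `losing D` IS `heavyLosing D w` — WLOG the strategy is perfect on the light inputs. -/
theorem losing_iff_heavy (D w : ℕ) : n ∈ losing D ↔ n ∈ heavyLosing D w := by
  constructor
  · intro h P hP _
    exact h P hP
  · intro h P hP
    by_cases hl : ∀ x : Fin n → Bool, OddZeros x → wt x ≤ w → Rel x (fun i => decide (P i x = 1))
    · exact h P hP hl
    · simp only [not_forall] at hl
      obtain ⟨x, hx, -, hR⟩ := hl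
      exact ⟨x, hx, hR⟩

/-- ★ EQUIV LAYER for the target: `NoPerfectTwo3 ↔ HeavyFail 2 w` for EVERY `w` (COSTUME by construction: the content is that a
would-be perfect quadratic strategy may be ASSUMED to solve the light family, i.e. to satisfy the light design equations of §3). -/
theorem noPerfectTwo3_iff_heavy (w : ℕ) : NoPerfectTwo3 ↔ HeavyFail 2 w := by
  rw [noPerfectTwo3_iff_losing]
  exact exists_congr fun n₀ => forall_congr' fun n => imp_congr_right fun _ => losing_iff_heavy 2 w

/-- the split beneath the EQUIV layer: the light law makes the heavy piece vacuous. -/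
theorem heavy_of_light {D w : ℕ} (h : n ∈ lightLosing D w) : n ∈ heavyLosing D w :=
  (losing_iff_heavy D w).mp (mem_losing_of_light h)

/-- the dial is MONOTONE in the weight bound. -/
theorem lightLosing_mono {D w w' : ℕ} (hw : w ≤ w') : lightLosing D w ⊆ lightLosing D w' := by
  intro n hn P hP
  obtain ⟨x, hx, hxw, hR⟩ := hn P hP
  exact ⟨x, hx, hxw.trans hw, hR⟩

/-- the dial is MONOTONE in the light threshold `w`. -/
theorem lightFail_mono {D w w' : ℕ} (hw : w ≤ w') (h : LightFail D w) : LightFail D w' := by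
  obtain ⟨n₀, hn₀⟩ := h
  exact ⟨n₀, fun n hn => lightLosing_mono hw (hn₀ n hn)⟩

/-- the dial is ANTITONE in the degree. -/
theorem lightLosing_anti {D D' w : ℕ} (hD : D ≤ D') : lightLosing D' w ⊆ lightLosing D w := by
  intro n hn P hP
  exact hn P fun i => lowDeg_mono hD (hP i)

/-- the dial is ANTITONE in the degree `D`. -/
theorem lightFail_anti {D D' w : ℕ} (hD : D ≤ D') (h : LightFail D' w) : LightFail D w := by
  obtain ⟨n₀, hn₀⟩ := h
  exact ⟨n₀, fun n hn => lightLosing_anti hD (hn₀ n hn)⟩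

/-- the weight bound may be capped at the length (every input has weight `≤ n`). -/
theorem wt_le (x : Fin n → Bool) : wt x ≤ n := by
  unfold wt
  exact (card_le_univ _).trans (by rw [Fintype.card_fin])

/-- at the top of the dial the light statement IS the slice: `lightLosing D w ∋ n ↔ losing D ∋ n` once `w ≥ n`. -/
theorem lightLosing_top {D w : ℕ} (hw : n ≤ w) : n ∈ lightLosing D w ↔ n ∈ losing D := by
  refine ⟨fun h => mem_losing_of_light h, fun h P hP => ?_⟩
  obtain ⟨x, hx, hR⟩ := h P hP
  exact ⟨x, hx, (wt_le x).trans hw, hR⟩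

/-- COVARIANT SLICE: a light defeat of every degree-`≤ D` strategy defeats in particular every covariant rule. -/
theorem lightCovLosing_of_lightLosing {D w : ℕ} (h : n ∈ lightLosing D w) : n ∈ lightCovLosing D w := by
  intro Q hQ
  obtain ⟨x, hx, hxw, hR⟩ := h (covStrat Q) (covStrat_mem_lowDeg hQ)
  exact ⟨x, hx, hxw, by rwa [cov_eq_covStrat]⟩

/-- a light covariant certificate is a covariant certificate: `lightCovLosing D w ⊆ covLosing D`. -/
theorem covLosing_of_lightCov {D w : ℕ} (h : n ∈ lightCovLosing D w) : n ∈ covLosing D := by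
  intro Q hQ
  obtain ⟨x, hx, -, hR⟩ := h Q hQ
  exact ⟨x, hx, hR⟩

/-- the fold amplifier (lineage g7, tree `covNotPerfectAt_mul`) on a light covariant certificate: `m·n ∈ covLosing D` for all odd `m`. -/
theorem covLosing_mul_of_lightCov {D w m : ℕ} (hm : Odd m) (hn : 3 ≤ n) (h : n ∈ lightCovLosing D w) :
    m * n ∈ covLosing D :=
  covNotPerfectAt_mul hm hn (covLosing_of_lightCov h)

/-! ## §2 Solvability of the ring relation on the odd class (a valid answer always exists) -/

/-- ★ on the odd class (`n ≥ 3`) the ring relation is solvable: a valid answer exists (the kernel is the pair `{0, kvec x}`,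
`kvec x ≠ 0`; answer `0` or a singleton at a support position of `kvec x` according to the sign bit). -/
theorem exists_rel_of_oddZeros (hn : 3 ≤ n) {x : Fin n → Bool} (hx : OddZeros x) : ∃ z : Fin n → Bool, Rel x z := by
  have hK := kernel_pair_of_oddZeros hn hx
  have hne := kvec_ne_zero hn hx
  obtain ⟨b, hb⟩ : ∃ b, kvec x b = true := by
    by_contra h
    exact hne (funext fun i => Bool.eq_false_iff.mpr fun hi => h ⟨i, hi⟩)
  by_cases hs : signBit x (kvec x) = 0
  · refine ⟨fun _ => false, (rel_iff_of_kernel_pair x (kvec x) _ hK).mpr ?_⟩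
    rw [hs]
    simp [dot2]
  · refine ⟨fun i => decide (i = b), (rel_iff_of_kernel_pair x (kvec x) _ hK).mpr ?_⟩
    rw [dot2_indicator, if_pos hb]
    have : signBit x (kvec x) < 2 := Nat.mod_lt _ (by norm_num)
    omega

end Summit.QuantumAdvantage.QuantumAdvantage.Theorems.LightDial
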